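import Mathlib
import Summits.NavierStokesRegularity.NavierStokesRegularity.Theorems.TaoLadderRungTwoBreakBlowupRigidityOneClockedFrontExtraction
import HarnessLib

/-!
# The MINIMAL type-I-free front bundle: {action ceiling, amplitude ceiling `B ν^j`, floor with UPPER clock at ratio
  `ν² ≥ (1+ε₀)⁻¹`} ⇒ the conclusion of `stub_eternalFromBlowup` of K2(1) `TaoLadderRungTwoBreak.BlowupRigidityOne`
  (stmt-NavierStokesRegularity-20206) — the lower clock is free by re-selection, the upper clock replaces type I

MODEL lattice ODEs only (Tao 2016 §4 (4.8)/(4.12), §6.4); nothing here is a statement about the Navier–Stokes equations;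
NO item is closed (`--supports stmt-NavierStokesRegularity-20206`). Route-independent (general `m`; `m = 4` in the
stub-shaped corollary).

* `clock_of_front` — re-selection without type I: floor `c_f (ν²)^k ≤ ‖x_k(t_k)‖²` with upper clock
  `(Λ²ν²)^k (T-t_k)² ≤ κ₂` + amplitude ceiling + `Λν ≥ 1` ⇒ re-selected times with floor `c_f/2` and two-sided clock;
* `eternal_surviving_one_of_front` — **THE EXTRACTION FROM THE THREE-ITEM FRONT BUNDLE** (action ceiling; amplitude ceiling
  at `(1+ε₀)⁻¹ ≤ ν²`; floor with upper clock on every shell): `∃ W, IsEternal ε₀ α W ∧ EternalSurvivingFwd 1 ε₀ W`;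
* `stub_eternalFromBlowup_of_fronts` — the REGISTERED STUB SIGNATURE verbatim from that bundle attached to every robust
  blow-up below threshold. FINAL FORM of this hand's reduction: type I (N-39) is NOT needed for ⟨20206⟩'s extraction stub.

HONEST LABEL: the three-item front bundle («robust inviscid blow-up of a fixed-spread table is a front that reaches every
shell with energy fraction `ν^{2k} ≥ (1+ε₀)^{-k}` on the self-similar schedule, stays quiet before and bounded by the same
fraction») is OPEN — it is the (E2) content of the item; `stub_eternalIsDSS` untouched; no stub, crux or summit is proved.
-/

noncomputable section

-- the summit and its single sub-problem share the name (CONVENTIONS §1)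
set_option linter.dupNamespace false

open Set Filter Topology MeasureTheory

namespace Summit.NavierStokesRegularity.NavierStokesRegularity.Theorems

namespace BlowupRigidityOne

open Literature.Analysis.FluidPDE Literature.Analysis.FluidPDE.TaoCascade

variable {m : ℕ}

/-- **THE TWO-SIDED CLOCK BY RE-SELECTION, TYPE-I-FREE.** As `clock_of_pinning`, but the UPPER clock is taken as a
hypothesis at the given floor times — `(Λ²ν²)^k (T - t_k)² ≤ κ₂` («the front keeps the self-similar schedule») —
instead of being derived from a sup-norm type-I bound; the LOWER clock and the floor `c_f/2` at the re-selected times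
come from the energy-Lipschitz bound (`energy_lipschitz`, amplitude ceiling) exactly as before, and the upper clock
survives the pull-back with constant `(√κ₂ + c₀)²`. [cite: Tao2016AveragedNS, §4 (4.8)–(4.10), §6.4; cell vocabulary] -/
theorem clock_of_front {ε₀ T B ν cf κ₂ : ℝ} (hε : 0 < ε₀) (hT : 0 < T)
    {α : Fin m → Fin m → Fin m → ℤ × ℤ × ℤ → ℝ}
    {X : Fin m → ℤ → ℝ → ℝ} (hC1 : ∀ i n, ContDiffOn ℝ 1 (X i n) (Set.Ico 0 T))
    (hmot : ∀ i n t, 0 ≤ t → t < T → derivWithin (X i n) (Set.Ici 0) t = quadTerm ε₀ α X i n t)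
    (hB : 0 ≤ B) (hν : 0 < ν)
    (hamp : ∀ (j : ℤ) (t : ℝ), 0 ≤ t → t < T → ‖shellVec X j t‖ ≤ B * ν ^ j)
    (hΛν : 1 ≤ bigLam ε₀ * ν) (hcf : 0 < cf) (hκ₂ : 0 < κ₂)
    (hfire : ∀ k : ℕ, ∃ t : ℝ, 0 ≤ t ∧ t < T ∧ cf * (ν ^ 2) ^ k ≤ ‖shellVec X (k : ℤ) t‖ ^ 2 ∧
      (bigLam ε₀ ^ 2 * ν ^ 2) ^ k * (T - t) ^ 2 ≤ κ₂) :
    ∃ (κ₁ κ₂' : ℝ) (τ : ℕ → ℝ), 0 < κ₁ ∧ 0 < κ₂' ∧ (∀ k : ℕ, 0 ≤ τ k ∧ τ k < T) ∧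
      (∀ k : ℕ, cf / 2 * (ν ^ 2) ^ k ≤ ‖shellVec X (k : ℤ) (τ k)‖ ^ 2) ∧
      (∀ k : ℕ, κ₁ ≤ (bigLam ε₀ ^ 2 * ν ^ 2) ^ k * (T - τ k) ^ 2) ∧
      (∀ k : ℕ, (bigLam ε₀ ^ 2 * ν ^ 2) ^ k * (T - τ k) ^ 2 ≤ κ₂') := by
  have hΛ : 0 < bigLam ε₀ := bigLam_pos (by linarith)
  have s0 := shiftConst_nonneg α (0, 0, 0)
  have s1 := shiftConst_nonneg α (0, 0, 1)
  have sB : 0 ≤ shiftConst α (1, 0, 0) + shiftConst α (0, 1, 0) :=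
    add_nonneg (shiftConst_nonneg α _) (shiftConst_nonneg α _)
  have hΛi : 0 ≤ (bigLam ε₀)⁻¹ := (inv_pos.2 hΛ).le
  -- the energy-Lipschitz constant (`+1` keeps it positive)
  set K : ℝ := 2 * B ^ 3 * (shiftConst α (0, 0, 0) + (bigLam ε₀)⁻¹ * shiftConst α (0, 0, 1) * ν⁻¹ ^ 2
    + (shiftConst α (1, 0, 0) + shiftConst α (0, 1, 0)) * ν) + 1 with hK_def
  have hK1 : 2 * B ^ 3 * (shiftConst α (0, 0, 0) + (bigLam ε₀)⁻¹ * shiftConst α (0, 0, 1) * ν⁻¹ ^ 2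
      + (shiftConst α (1, 0, 0) + shiftConst α (0, 1, 0)) * ν) ≤ K := by rw [hK_def]; linarith
  have hK0 : 0 < K := by
    have : 0 ≤ 2 * B ^ 3 * (shiftConst α (0, 0, 0) + (bigLam ε₀)⁻¹ * shiftConst α (0, 0, 1) * ν⁻¹ ^ 2
        + (shiftConst α (1, 0, 0) + shiftConst α (0, 1, 0)) * ν) := by positivity
    rw [hK_def]; linarith
  set ρ : ℝ := bigLam ε₀ * ν with hρ_def
  have hρ : 0 < ρ := by positivity
  have hρk : ∀ k : ℕ, 1 ≤ ρ ^ k := fun k => one_le_pow₀ hΛν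
  set c₀ : ℝ := min (cf / (2 * K)) T with hc₀_def
  have hc₀ : 0 < c₀ := lt_min (by positivity) hT
  have hc₀K : c₀ ≤ cf / (2 * K) := min_le_left _ _
  have hc₀T : c₀ ≤ T := min_le_right _ _
  -- original floor times, pulled back by `δ_k = c₀ (Λν)^{-k}`
  choose tf htf using hfire
  have hδ : ∀ k : ℕ, 0 < c₀ * (ρ ^ k)⁻¹ := fun k => by positivity
  have hδle : ∀ k : ℕ, c₀ * (ρ ^ k)⁻¹ ≤ c₀ := fun k => by
    have : (ρ ^ k)⁻¹ ≤ 1 := inv_le_one_of_one_le₀ (hρk k)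
    calc c₀ * (ρ ^ k)⁻¹ ≤ c₀ * 1 := mul_le_mul_of_nonneg_left this hc₀.le
      _ = c₀ := mul_one _
  refine ⟨c₀ ^ 2, (Real.sqrt κ₂ + c₀) ^ 2, fun k => max (tf k - c₀ * (ρ ^ k)⁻¹) 0, by positivity, by positivity,
    ?_⟩
  -- per-shell facts
  have key : ∀ k : ℕ, (0 ≤ max (tf k - c₀ * (ρ ^ k)⁻¹) 0 ∧ max (tf k - c₀ * (ρ ^ k)⁻¹) 0 < T) ∧
      cf / 2 * (ν ^ 2) ^ k ≤ ‖shellVec X (k : ℤ) (max (tf k - c₀ * (ρ ^ k)⁻¹) 0)‖ ^ 2 ∧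
      c₀ ^ 2 ≤ (bigLam ε₀ ^ 2 * ν ^ 2) ^ k * (T - max (tf k - c₀ * (ρ ^ k)⁻¹) 0) ^ 2 ∧
      (bigLam ε₀ ^ 2 * ν ^ 2) ^ k * (T - max (tf k - c₀ * (ρ ^ k)⁻¹) 0) ^ 2 ≤ (Real.sqrt κ₂ + c₀) ^ 2 := by
    intro k
    obtain ⟨ht0, htT, hfl, hupk⟩ := htf k
    set τ := max (tf k - c₀ * (ρ ^ k)⁻¹) 0 with hτ_def
    have hτ0 : 0 ≤ τ := le_max_right _ _
    have hτle : τ ≤ tf k := max_le (by linarith [hδ k]) ht0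
    have hτT : τ < T := lt_of_le_of_lt hτle htT
    have hgap : tf k - τ ≤ c₀ * (ρ ^ k)⁻¹ := by
      have h := le_max_left (tf k - c₀ * (ρ ^ k)⁻¹) 0
      linarith
    have hq : (bigLam ε₀ ^ 2 * ν ^ 2) ^ k = (ρ ^ k) ^ 2 := by
      rw [hρ_def, ← mul_pow, ← pow_mul, ← pow_mul, Nat.mul_comm]
    -- the floor survives the pull-back
    have hLip := energy_lipschitz hε hC1 hmot hB hν hamp k (s := τ) (t := tf k) ⟨hτ0, hτT⟩ ⟨ht0, htT⟩
    have hfloor : cf / 2 * (ν ^ 2) ^ k ≤ ‖shellVec X (k : ℤ) τ‖ ^ 2 := by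
      have h1 : ‖shellVec X (k : ℤ) (tf k)‖ ^ 2 - ‖shellVec X (k : ℤ) τ‖ ^ 2 ≤
          K * (bigLam ε₀ * ν ^ 3) ^ k * (c₀ * (ρ ^ k)⁻¹) := by
        rw [abs_of_nonneg (by linarith : 0 ≤ tf k - τ)] at hLip
        calc ‖shellVec X (k : ℤ) (tf k)‖ ^ 2 - ‖shellVec X (k : ℤ) τ‖ ^ 2
            ≤ (2 * B ^ 3 * (shiftConst α (0, 0, 0) + (bigLam ε₀)⁻¹ * shiftConst α (0, 0, 1) * ν⁻¹ ^ 2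
              + (shiftConst α (1, 0, 0) + shiftConst α (0, 1, 0)) * ν)) * (bigLam ε₀ * ν ^ 3) ^ k * (tf k - τ) :=
              (le_abs_self _).trans hLip
          _ ≤ K * (bigLam ε₀ * ν ^ 3) ^ k * (c₀ * (ρ ^ k)⁻¹) :=
              mul_le_mul (mul_le_mul_of_nonneg_right hK1 (by positivity)) hgap (by linarith) (by positivity)
      have h2 : K * (bigLam ε₀ * ν ^ 3) ^ k * (c₀ * (ρ ^ k)⁻¹) = K * c₀ * (ν ^ 2) ^ k := by
        rw [hρ_def]
        have hρk0 : (bigLam ε₀ * ν) ^ k ≠ 0 := (pow_pos hρ k).ne'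
        rw [show (bigLam ε₀ * ν ^ 3) ^ k = (bigLam ε₀ * ν) ^ k * (ν ^ 2) ^ k by
          rw [← mul_pow]; ring]
        field_simp
      have h3 : K * c₀ * (ν ^ 2) ^ k ≤ cf / 2 * (ν ^ 2) ^ k := by
        refine mul_le_mul_of_nonneg_right ?_ (by positivity)
        calc K * c₀ ≤ K * (cf / (2 * K)) := mul_le_mul_of_nonneg_left hc₀K hK0.le
          _ = cf / 2 := by field_simp
      linarith
    -- the lower clock: `T - τ ≥ δ_k`
    have hlow : c₀ * (ρ ^ k)⁻¹ ≤ T - τ := by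
      rcases le_total (tf k - c₀ * (ρ ^ k)⁻¹) 0 with h | h
      · have hτeq : τ = 0 := by rw [hτ_def]; exact max_eq_right h
        rw [hτeq, sub_zero]
        exact (hδle k).trans hc₀T
      · have hτeq : τ = tf k - c₀ * (ρ ^ k)⁻¹ := by rw [hτ_def]; exact max_eq_left h
        rw [hτeq]
        linarith
    have hclock₁ : c₀ ^ 2 ≤ (bigLam ε₀ ^ 2 * ν ^ 2) ^ k * (T - τ) ^ 2 := by
      rw [hq]
      have h1 : c₀ ≤ ρ ^ k * (T - τ) := by
        have h := mul_le_mul_of_nonneg_left hlow (pow_pos hρ k).le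
        have e : ρ ^ k * (c₀ * (ρ ^ k)⁻¹) = c₀ := by field_simp
        rwa [e] at h
      calc c₀ ^ 2 ≤ (ρ ^ k * (T - τ)) ^ 2 := pow_le_pow_left₀ hc₀.le h1 2
        _ = (ρ ^ k) ^ 2 * (T - τ) ^ 2 := by ring
    -- the upper clock: the given clock at `tf k` plus the pull-back `δ_k ≤ c₀ ρ^{-k}`
    have hclock₂ : (bigLam ε₀ ^ 2 * ν ^ 2) ^ k * (T - τ) ^ 2 ≤ (Real.sqrt κ₂ + c₀) ^ 2 := by
      rw [hq]
      have hu1 : ρ ^ k * (T - tf k) ≤ Real.sqrt κ₂ := by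
        have h : (ρ ^ k * (T - tf k)) ^ 2 ≤ κ₂ := by
          rw [mul_pow, ← hq]; exact hupk
        exact (le_abs_self _).trans (Real.abs_le_sqrt h)
      have hu2 : ρ ^ k * (T - τ) ≤ ρ ^ k * (T - tf k) + ρ ^ k * (c₀ * (ρ ^ k)⁻¹) := by
        rw [← mul_add]
        exact mul_le_mul_of_nonneg_left (by linarith) (pow_pos hρ k).le
      have hu3 : ρ ^ k * (c₀ * (ρ ^ k)⁻¹) = c₀ := by field_simp
      have hu4 : ρ ^ k * (T - τ) ≤ Real.sqrt κ₂ + c₀ := by linarith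
      have hu0 : 0 ≤ ρ ^ k * (T - τ) := mul_nonneg (pow_pos hρ k).le (by linarith)
      calc (ρ ^ k) ^ 2 * (T - τ) ^ 2 = (ρ ^ k * (T - τ)) ^ 2 := by ring
        _ ≤ (Real.sqrt κ₂ + c₀) ^ 2 := pow_le_pow_left₀ hu0 hu4 2
    exact ⟨⟨hτ0, hτT⟩, hfloor, hclock₁, hclock₂⟩
  exact ⟨fun k => (key k).1, fun k => (key k).2.1, fun k => (key k).2.2.1, fun k => (key k).2.2.2⟩


/-- **THE EXTRACTION FROM THE THREE-ITEM FRONT BUNDLE (a = 1), no type I.** An exact flow of `α` on `[0,T)` with a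
per-shell ACTION CEILING, an AMPLITUDE CEILING `‖x_j(t)‖ ≤ B ν^j` at an (S₁)-surviving ratio `(1+ε₀)⁻¹ ≤ ν²`, and on
every shell `k ∈ ℕ` a time `t_k ∈ [0,T)` with FLOOR `c_f (ν²)^k ≤ ‖x_k(t_k)‖²` and UPPER CLOCK `(Λ²ν²)^k (T-t_k)² ≤ κ₂`,
has an admissible eternal ω-limit that is (S₁)-surviving forward: `∃ W, IsEternal ε₀ α W ∧ EternalSurvivingFwd 1 ε₀ W`.
[cite: Tao2016AveragedNS, §4 Thm. 4.2 (statement shape), (4.8)–(4.10), §6.4; KochNadirashviliSereginSverak2009, Thm 1.1 ff.; cell vocabulary] -/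
theorem eternal_surviving_one_of_front {ε₀ T A B ν cf κ₂ : ℝ} (hε : 0 < ε₀) (hT : 0 < T)
    {α : Fin m → Fin m → Fin m → ℤ × ℤ × ℤ → ℝ}
    {X : Fin m → ℤ → ℝ → ℝ} (hC1 : ∀ i n, ContDiffOn ℝ 1 (X i n) (Set.Ico 0 T))
    (hmot : ∀ i n t, 0 ≤ t → t < T → derivWithin (X i n) (Set.Ici 0) t = quadTerm ε₀ α X i n t)
    (hact : ∀ k : ℤ, IntegrableOn (fun t => ‖shellVec X k t‖) (Ico 0 T) ∧
      bigLam ε₀ ^ k * (∫ t in Ico 0 T, ‖shellVec X k t‖) ≤ A)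
    (hν : 0 < ν) (hν1 : (1 + ε₀)⁻¹ ≤ ν ^ 2)
    (hamp : ∀ (j : ℤ) (t : ℝ), 0 ≤ t → t < T → ‖shellVec X j t‖ ≤ B * ν ^ j)
    (hcf : 0 < cf) (hκ₂ : 0 < κ₂)
    (hfire : ∀ k : ℕ, ∃ t : ℝ, 0 ≤ t ∧ t < T ∧ cf * (ν ^ 2) ^ k ≤ ‖shellVec X (k : ℤ) t‖ ^ 2 ∧
      (bigLam ε₀ ^ 2 * ν ^ 2) ^ k * (T - t) ^ 2 ≤ κ₂) :
    ∃ Wlim : ℤ → ℝ → Em m, IsEternal ε₀ α Wlim ∧ EternalSurvivingFwd 1 ε₀ Wlim := by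
  have hb : (0 : ℝ) < 1 + ε₀ := by linarith
  have hΛ : 0 < bigLam ε₀ := bigLam_pos (by linarith)
  have hB : 0 ≤ B := by
    have h := hamp 0 0 le_rfl hT
    rw [zpow_zero, mul_one] at h
    exact (norm_nonneg _).trans h
  have hΛν : 1 ≤ bigLam ε₀ * ν := by
    have h2 : 1 ≤ (bigLam ε₀ * ν) ^ 2 := by
      rw [mul_pow, bigLam_sq hε]
      calc (1 : ℝ) ≤ (1 + ε₀) ^ 4 := one_le_pow₀ (by linarith)
        _ = (1 + ε₀) ^ 5 * (1 + ε₀)⁻¹ := by field_simp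
        _ ≤ (1 + ε₀) ^ 5 * ν ^ 2 := mul_le_mul_of_nonneg_left hν1 (pow_pos hb 5).le
    by_contra h
    push Not at h
    have : (bigLam ε₀ * ν) ^ 2 < 1 := pow_lt_one₀ (by positivity) h two_ne_zero
    linarith
  obtain ⟨κ₁, κ₂', τ, hκ₁, hκ₂', hτ, hfloor, hclock₁, hclock₂⟩ :=
    clock_of_front hε hT hC1 hmot hB hν hamp hΛν hcf hκ₂ hfire
  exact eternal_surviving_one_of_clockedFront hε hT hC1 hmot hact hν hν1 hamp hτ hfloor hclock₁ hclock₂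
    (by positivity) hκ₁ hκ₂'

/-- **FINAL FORM — THE REGISTERED STUB `stub_eternalFromBlowup` MODULO THE THREE-ITEM FRONT BUNDLE, no type I.** If below a
threshold every robust blow-up (`NoGlobalCascade ε₀ α X₀`) of a table `α ∈ E₂(R)` admits SOME exact flow of `α` on some
`[0,T)` with (i) a per-shell ACTION CEILING, (ii) an AMPLITUDE CEILING `B ν^j` with `(1+ε₀)⁻¹ ≤ ν²`, (iii) on every shell a
FLOOR time on the self-similar schedule (`c_f (ν²)^k ≤ ‖x_k(t_k)‖²`, `(Λ²ν²)^k (T-t_k)² ≤ κ₂`), then the signature of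
`stub_eternalFromBlowup` (skeleton `9d85f4d387c689cd` of item 20206) holds verbatim.
[cite: Tao2016AveragedNS, §4 Thm. 4.2, §6.4; KochNadirashviliSereginSverak2009, Thm 1.1 ff.; cell vocabulary (`NoGlobalCascade`, `IsEternal`, `EternalSurvivingFwd`)] -/
theorem stub_eternalFromBlowup_of_fronts
    (H : ∀ R : ℝ, 1 ≤ R → ∃ εs : ℝ, 0 < εs ∧ ∀ ε₀ : ℝ, 0 < ε₀ → ε₀ ≤ εs →
      ∀ (α : (Fin 4 → Fin 4 → Fin 4 → ℤ × ℤ × ℤ → ℝ)) (X₀ : Fin 4 → ℝ),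
        InTableClass R α → NoGlobalCascade ε₀ α X₀ →
        ∃ (T A B ν cf κ₂ : ℝ) (X : Fin 4 → ℤ → ℝ → ℝ), 0 < T ∧
          (∀ i n, ContDiffOn ℝ 1 (X i n) (Set.Ico 0 T)) ∧
          (∀ i n t, 0 ≤ t → t < T → derivWithin (X i n) (Set.Ici 0) t = quadTerm ε₀ α X i n t) ∧
          (∀ k : ℤ, IntegrableOn (fun t => ‖shellVec X k t‖) (Ico 0 T) ∧
            bigLam ε₀ ^ k * (∫ t in Ico 0 T, ‖shellVec X k t‖) ≤ A) ∧
          0 < ν ∧ (1 + ε₀)⁻¹ ≤ ν ^ 2 ∧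
          (∀ (j : ℤ) (t : ℝ), 0 ≤ t → t < T → ‖shellVec X j t‖ ≤ B * ν ^ j) ∧
          0 < cf ∧ 0 < κ₂ ∧
          (∀ k : ℕ, ∃ t : ℝ, 0 ≤ t ∧ t < T ∧ cf * (ν ^ 2) ^ k ≤ ‖shellVec X (k : ℤ) t‖ ^ 2 ∧
            (bigLam ε₀ ^ 2 * ν ^ 2) ^ k * (T - t) ^ 2 ≤ κ₂)) :
    ∀ R : ℝ, 1 ≤ R → ∃ εs : ℝ, 0 < εs ∧ ∀ ε₀ : ℝ, 0 < ε₀ → ε₀ ≤ εs →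
      ∀ (α : (Fin 4 → Fin 4 → Fin 4 → ℤ × ℤ × ℤ → ℝ)) (X₀ : Fin 4 → ℝ),
        Literature.Analysis.FluidPDE.TaoCascade.InTableClass R α →
        Literature.Analysis.FluidPDE.TaoCascade.NoGlobalCascade ε₀ α X₀ →
        ∃ W : ℤ → ℝ → Literature.Analysis.FluidPDE.TaoCascade.Em 4,
          Literature.Analysis.FluidPDE.TaoCascade.IsEternal ε₀ α W ∧
          Literature.Analysis.FluidPDE.TaoCascade.EternalSurvivingFwd 1 ε₀ W := by
  intro R hR
  obtain ⟨εs, hεs, hH⟩ := H R hR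
  refine ⟨εs, hεs, fun ε₀ hε hεle α X₀ hα hNG => ?_⟩
  obtain ⟨T, A, B, ν, cf, κ₂, X, hT, hC1, hmot, hact, hν, hν1, hamp, hcf, hκ₂, hfire⟩ := hH ε₀ hε hεle α X₀ hα hNG
  exact eternal_surviving_one_of_front hε hT hC1 hmot hact hν hν1 hamp hcf hκ₂ hfire

end BlowupRigidityOne

end Summit.NavierStokesRegularity.NavierStokesRegularity.Theorems

end
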